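import Literature.Computability.Complexity.CountingHierarchyPPoly
import Literature.Computability.Complexity.CircuitEval
import Literature.Computability.Complexity.PolyAdviceClosure
import Literature.Computability.Complexity.CircuitClassesProofs
import Literature.Computability.AlgebraicComplexity.ValiantClassesProofs
import Summits.ValiantsHypothesis.ValiantsHypothesis.Theorems.DetqpThesis.Negative.NotQPBoundedOfExp

/-!
# Crux `IntegralOrbits.TauBurgisserDet` (stmt-ValiantsHypothesis-7680), line `registered` —
# registered stub `stub_chCollapseQP`

**Bürgisser 2009, Lemma 2.5(2), at quasi-polynomial granularity.**  Write
`qpSIZE = ⋃ c, SIZE (n ↦ 2 ^ ((log₂ n + c) ^ c))` for the languages decided by `B₂`-circuit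
families of quasi-polynomial size.  Then `PP ⊆ qpSIZE ⇒ CH ⊆ qpSIZE`.

## Proof

The tree's polynomial proof (`Literature.Computability.Complexity.CountingHierarchyPPoly`,
`pMajority_PPoly_subset_PPoly` / `CkP_subset_PPoly_of`) re-run with quasi-polynomial bookkeeping;
the only new point is `qp ∘ qp = qp` (`ChCollapseQP.qp_comp`; monotonicity in the constant is the
tree's `DetqpThesis.Negative.qpBound_mono`).  Induction on the level `k` of
`CₖP`: `C₀P = P ⊆ C₁P = PP ⊆ qpSIZE` by hypothesis.  Step `C'·qpSIZE ⊆ qpSIZE`: for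
`L ∈ C'·qpSIZE` with witness `L' ∈ SIZE (2 ^ ((log₂ · + c₁) ^ c₁))` (circuits `C_m`) and coin
polynomial `p`,
* `z ∈ L' ↔ ⟨z, desc C_{|z|}⟩ ∈ EvalLang` with `EvalLang ∈ P` (circuit evaluation,
  `CircEval.evalFn_boolPair_desc`) and `|desc C_m| ≤ (s m + 1)(8 (m + s m) + 10)`
  (`ChCollapseQP.advice_of_mem_SIZE`);
* the majority vote with the advice moved into the input,
  `M = {⟨x, b⟩ | Pr_y[⟨⟨x, y↾p|x|⟩, b⟩ ∈ EvalLang] > 1/2}`, is in `PP` (verbatim from the template: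
  `adviceCoinFn_mem_FP`, `adviceCoinFn_apply`, `uniformProb_take_of_le`, `uniformProb_congr`) and
  `x ∈ L ↔ ⟨x, a |x|⟩ ∈ M` with `a n = desc C_{2n + 2 + p n}` (`ChCollapseQP.majority_step`);
* `M ∈ qpSIZE` by hypothesis, say `M ∈ SIZE (2 ^ ((log₂ · + c₂) ^ c₂))`; hard-wiring the advice
  `a n` into the circuits for `M` on pairs (`cktSize_pairVec`, `CktSize.hardwire`, `.toCircuit`)
  gives `L ∈ SIZE (n ↦ N' + 2 ^ ((log₂ N' + c₂) ^ c₂) + 2)`, `N' = 2n + 2 + |a n|`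
  (`ChCollapseQP.mem_SIZE_of_advice`);
* `N' + 2 ^ ((log₂ N' + c₂) ^ c₂) + 2 ≤ 2 ^ ((log₂ n + c₃) ^ c₃)` for a constant `c₃`
  (`ChCollapseQP.final_bound`: polynomials are quasi-polynomially bounded,
  `IsPBounded.isQPBounded`, and `m ≤ 2 ^ ((log₂ n + c) ^ c)` implies
  `2 ^ ((log₂ m + e) ^ e) ≤ 2 ^ ((log₂ n + c') ^ c')` with `c' = (c + e + 2)²`).

Unconditional (axioms `propext`, `Classical.choice`, `Quot.sound`). References: P. Bürgisser, *On
defining integers and proving arithmetic circuit lower bounds*, Comput. Complexity 18 (2009) =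
ECCC TR06-113, Lemma 2.5(2); S. Arora, B. Barak, *Computational Complexity*, CUP 2009, Thm. 6.18.
-/

-- layout Summits/ValiantsHypothesis/ValiantsHypothesis forces the duplicated namespace component
set_option linter.dupNamespace false

namespace Summit.ValiantsHypothesis.ValiantsHypothesis.Theorems.IntegralOrbitsTauBurgisserDet

open Polynomial Literature.Computability.Complexity Literature.Computability.AlgebraicComplexity
open Summit.ValiantsHypothesis.Theorems.DetqpThesis.Negative (qpBound_mono)

namespace ChCollapseQP
/-! ### Quasi-polynomial arithmetic -/

/-- Polynomials are quasi-polynomially bounded (`IsPBounded.isQPBounded`). [folklore] -/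
theorem qp_of_poly (p : Polynomial ℕ) : ∃ c : ℕ, ∀ n, p.eval n ≤ 2 ^ ((Nat.log 2 n + c) ^ c) :=
  ((isPBounded_iff_exists_polynomial_holds _).2 ⟨p, fun _ => le_rfl⟩).isQPBounded

/-- **`qp ∘ qp = qp`**: if `m ≤ 2 ^ ((log₂ n + c) ^ c)` then
`2 ^ ((log₂ m + e) ^ e) ≤ 2 ^ ((log₂ n + c') ^ c')` with `c' = (c + e + 2)²`. [folklore] -/
theorem qp_comp (c e : ℕ) : ∃ c' : ℕ, ∀ n m : ℕ, m ≤ 2 ^ ((Nat.log 2 n + c) ^ c) →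
    2 ^ ((Nat.log 2 m + e) ^ e) ≤ 2 ^ ((Nat.log 2 n + c') ^ c') := by
  refine ⟨(c + e + 2) * (c + e + 2), fun n m hm => Nat.pow_le_pow_right two_pos ?_⟩
  set L := Nat.log 2 n with hL
  set K := c + e + 2 with hK
  set M := L + K with hM
  have hlog : Nat.log 2 m ≤ (L + c) ^ c := by
    have := Nat.log_mono_right (b := 2) hm
    rwa [Nat.log_pow one_lt_two] at this
  have hM1 : 1 ≤ M := by omega
  have h1 : (L + c) ^ c ≤ M ^ (c + 1) :=
    (Nat.pow_le_pow_left (by omega) c).trans (Nat.pow_le_pow_right hM1 (Nat.le_succ c))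
  have h2 : e ≤ M ^ (c + 1) := (by omega : e ≤ M).trans (Nat.le_self_pow (by omega) M)
  have h3 : Nat.log 2 m + e ≤ M ^ (c + 2) :=
    calc Nat.log 2 m + e ≤ M ^ (c + 1) + M ^ (c + 1) := Nat.add_le_add (hlog.trans h1) h2
      _ = 2 * M ^ (c + 1) := by ring
      _ ≤ M * M ^ (c + 1) := Nat.mul_le_mul_right _ (by omega)
      _ = M ^ (c + 2) := by ring
  have hKK : K ≤ K * K := Nat.le_mul_of_pos_left K (by omega)
  calc (Nat.log 2 m + e) ^ e ≤ (M ^ (c + 2)) ^ e := Nat.pow_le_pow_left h3 e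
    _ = M ^ ((c + 2) * e) := by rw [← pow_mul]
    _ ≤ (L + K * K) ^ ((c + 2) * e) := Nat.pow_le_pow_left (by omega) _
    _ ≤ (L + K * K) ^ (K * K) :=
        Nat.pow_le_pow_right (by omega) (Nat.mul_le_mul (by omega) (by omega))

/-- The size bookkeeping of the induction step: with `N = 2n + 2 + p n`,
`S = 2 ^ ((log₂ N + c₁) ^ c₁)` and advice length `A ≤ (S + 1)(8 (N + S) + 10)`, the hard-wired
family has quasi-polynomial size
`(2n + 2 + A) + 2 ^ ((log₂ (2n + 2 + A) + c₂) ^ c₂) + 2 ≤ 2 ^ ((log₂ n + c₃) ^ c₃)`. [folklore] -/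
theorem final_bound (c₁ c₂ : ℕ) (p : Polynomial ℕ) : ∃ c₃ : ℕ, ∀ n A : ℕ,
    A ≤ (2 ^ ((Nat.log 2 (2 * n + 2 + p.eval n) + c₁) ^ c₁) + 1) *
        (8 * ((2 * n + 2 + p.eval n) + 2 ^ ((Nat.log 2 (2 * n + 2 + p.eval n) + c₁) ^ c₁)) + 10) →
      (2 * n + 2 + A) + 2 ^ ((Nat.log 2 (2 * n + 2 + A) + c₂) ^ c₂) + 2 ≤
        2 ^ ((Nat.log 2 n + c₃) ^ c₃) := by
  obtain ⟨d₁, hd₁⟩ := qp_of_poly (2 * X + 2 + p)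
  obtain ⟨d₂, hd₂⟩ := qp_comp d₁ c₁
  obtain ⟨d₃, hd₃⟩ := qp_of_poly (2 * X + 2 + (X + 1) * (8 * (X + X) + 10))
  obtain ⟨d₄, hd₄⟩ := qp_comp (max d₁ d₂) d₃
  obtain ⟨d₅, hd₅⟩ := qp_comp d₄ c₂
  obtain ⟨d₆, hd₆⟩ := qp_of_poly (X + X + 2)
  obtain ⟨d₇, hd₇⟩ := qp_comp (max d₄ d₅) d₆
  refine ⟨d₇, fun n A hA => ?_⟩
  -- `N = 2n + 2 + p n` and `S` are dominated by `U = 2 ^ ((log₂ n + max d₁ d₂) ^ max d₁ d₂)`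
  have hN : 2 * n + 2 + p.eval n ≤ 2 ^ ((Nat.log 2 n + d₁) ^ d₁) := by
    simpa only [eval_add, eval_mul, eval_ofNat, eval_X] using hd₁ n
  have hS : 2 ^ ((Nat.log 2 (2 * n + 2 + p.eval n) + c₁) ^ c₁) ≤ 2 ^ ((Nat.log 2 n + d₂) ^ d₂) :=
    hd₂ n _ hN
  set U := 2 ^ ((Nat.log 2 n + max d₁ d₂) ^ max d₁ d₂) with hU
  have hNU : 2 * n + 2 + p.eval n ≤ U := hN.trans (qpBound_mono (le_max_left _ _) n)
  have hSU : 2 ^ ((Nat.log 2 (2 * n + 2 + p.eval n) + c₁) ^ c₁) ≤ U :=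
    hS.trans (qpBound_mono (le_max_right _ _) n)
  -- hence so is `N' = 2n + 2 + A`
  have hA' : A ≤ (U + 1) * (8 * (U + U) + 10) := hA.trans (Nat.mul_le_mul (by omega) (by omega))
  have hN'U : 2 * n + 2 + A ≤ 2 * U + 2 + (U + 1) * (8 * (U + U) + 10) := by omega
  have hN' : 2 * n + 2 + A ≤ 2 ^ ((Nat.log 2 n + d₄) ^ d₄) := by
    refine hN'U.trans (le_trans ?_ (hd₄ n U le_rfl))
    simpa only [eval_add, eval_mul, eval_ofNat, eval_X, eval_one] using hd₃ U
  -- and the circuit size for `M` at length `N'`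
  have hM : 2 ^ ((Nat.log 2 (2 * n + 2 + A) + c₂) ^ c₂) ≤ 2 ^ ((Nat.log 2 n + d₅) ^ d₅) :=
    hd₅ n _ hN'
  set V := 2 ^ ((Nat.log 2 n + max d₄ d₅) ^ max d₄ d₅) with hV
  have h1 : 2 * n + 2 + A ≤ V := hN'.trans (qpBound_mono (le_max_left _ _) n)
  have h2 : 2 ^ ((Nat.log 2 (2 * n + 2 + A) + c₂) ^ c₂) ≤ V :=
    hM.trans (qpBound_mono (le_max_right _ _) n)
  have h3 : V + V + 2 ≤ 2 ^ ((Nat.log 2 V + d₆) ^ d₆) := by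
    simpa only [eval_add, eval_ofNat, eval_X] using hd₆ V
  calc (2 * n + 2 + A) + 2 ^ ((Nat.log 2 (2 * n + 2 + A) + c₂) ^ c₂) + 2 ≤ V + V + 2 := by omega
    _ ≤ 2 ^ ((Nat.log 2 V + d₆) ^ d₆) := h3
    _ ≤ 2 ^ ((Nat.log 2 n + d₇) ^ d₇) := hd₇ n V le_rfl

/-! ### Circuit families as `P` with advice, and hard-wiring advice -/

/-- A `SIZE s` language is circuit evaluation (`EvalLang ∈ P`) with the description of the `m`-th
circuit as advice, of length `≤ (s m + 1)(8 (m + s m) + 10)` (the proof of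
`PPoly_subset_polyAdvice_P` for a general size bound). [folklore] -/
theorem advice_of_mem_SIZE {L' : Language Bool} {s : ℕ → ℕ} (hL' : L' ∈ SIZE s) :
    ∃ adv : ℕ → List Bool, (∀ m, (adv m).length ≤ (s m + 1) * (8 * (m + s m) + 10)) ∧
      ∀ z, z ∈ L' ↔ boolPair z (adv z.length) ∈ CircEval.EvalLang := by
  obtain ⟨C, hC, hdec⟩ := hL'
  have har : ∀ n, ∀ g ∈ (C n).gates, g.arity ≤ 2 := fun n g hg => (hC n).1 g hg
  refine ⟨fun n => CircEval.desc (C n), fun m => ?_, fun z => ?_⟩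
  · refine (CircEval.length_desc_le (C m)).trans ?_
    have hs : (C m).size ≤ s m := (hC m).2
    exact Nat.mul_le_mul (by omega) (by omega)
  · change z ∈ L' ↔ CircEval.evalFn (boolPair z (CircEval.desc (C z.length))) = [true]
    rw [CircEval.evalFn_boolPair_desc z (C z.length) (har z.length), hdec z, List.cons.injEq]
    simp only [and_true]
    exact Set.mem_iff_boolIndicator L' z

/-- Unpacking `M ∈ SIZE s` on paired inputs `⟨x, y⟩`, `|x| = n`, `|y| = m`: the map
`(x, y) ↦ [⟨x, y⟩ ∈ M]` has `B₂`-circuits of size `N + s N`, `N = 2n + 2 + m`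
(`exists_cktSize_boolPair_of_mem_PPoly` for a general size bound). [folklore] -/
theorem cktSize_boolPair_of_mem_SIZE {M : Language Bool} {s : ℕ → ℕ} (hM : M ∈ SIZE s) (n m : ℕ) :
    CktSize B2 (fun (w : Fin n ⊕ Fin m → Bool) (_ : Unit) =>
      M.boolIndicator (boolPair (List.ofFn fun i => w (.inl i)) (List.ofFn fun j => w (.inr j))))
      ((2 * n + 2 + m) + s (2 * n + 2 + m)) := by
  obtain ⟨C, hC, hdec⟩ := hM
  have h1 := cktSize_pairVec n m
  have h2 := ((C (2 * n + 2 + m)).cktSize_eval (hC _).1).of_le (hC _).2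
  refine (h1.comp h2).congr fun w _ => ?_
  rw [← ofFn_pairVec]
  exact hdec.eval_eq _

/-- **Hard-wiring advice into circuits**: if `M ∈ SIZE s` and `x ∈ L ↔ ⟨x, a |x|⟩ ∈ M`, then
`L ∈ SIZE (n ↦ N' + s N' + 2)`, `N' = 2n + 2 + |a n|` (the proof of
`polyAdvice_PPoly_subset_PPoly` for a general size bound). [folklore] -/
theorem mem_SIZE_of_advice {M L : Language Bool} {s : ℕ → ℕ} (hM : M ∈ SIZE s) (a : ℕ → List Bool)
    (hL : ∀ x, x ∈ L ↔ boolPair x (a x.length) ∈ M) :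
    L ∈ SIZE (fun n => (2 * n + 2 + (a n).length) + s (2 * n + 2 + (a n).length) + 2) := by
  classical
  have main : ∀ n : ℕ, ∃ D : Circuit (Fin n), D.IsOver B2 ∧
      D.size ≤ (2 * n + 2 + (a n).length) + s (2 * n + 2 + (a n).length) + 2 ∧
      ∀ u : Fin n → Bool, D.eval u = L.boolIndicator (List.ofFn u) := by
    intro n
    obtain ⟨D, hDB, hDs, hDe⟩ :=
      ((cktSize_boolPair_of_mem_SIZE hM n (a n).length).hardwire (a n).get).toCircuit
    refine ⟨D, hDB, hDs, fun u => (hDe u).trans ?_⟩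
    simp only [Sum.elim_inl, Sum.elim_inr, List.ofFn_get]
    exact boolIndicator_eq_of_iff ((hL (List.ofFn u)).trans (by rw [List.length_ofFn])).symm
  choose D hD using main
  refine ⟨D, fun n => ⟨(hD n).1, (hD n).2.1⟩, fun x => ?_⟩
  have := (hD x.length).2.2 x.get
  rwa [List.ofFn_get] at this

/-! ### The majority vote with the advice moved into the input -/

/-- **The `PP` language of the induction step**: for a `P` language `L''`, advice `adv` with
`z ∈ L' ↔ ⟨z, adv |z|⟩ ∈ L''` and a coin polynomial `p`, the majority vote
`M = {⟨x, b⟩ | Pr_y[⟨⟨x, y↾p|x|⟩, b⟩ ∈ L''] > 1/2}` is in `PP` and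
`Pr_{y ∈ {0,1}^{p|x|}}[⟨x, y⟩ ∈ L'] > 1/2 ↔ ⟨x, adv (2|x| + 2 + p|x|)⟩ ∈ M` (verbatim from
`pMajority_PPoly_subset_PPoly`). [folklore] -/
theorem majority_step {L' L'' : Language Bool} (hL''P : L'' ∈ Classes.P) (adv : ℕ → List Bool)
    (ha : ∀ z, z ∈ L' ↔ boolPair z (adv z.length) ∈ L'') (p : Polynomial ℕ) :
    ∃ M ∈ PP, ∀ x : List Bool,
      (1 / 2 < uniformProb (p.eval x.length) {y : List Bool | boolPair x y ∈ L'}) ↔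
        boolPair x (adv (2 * x.length + 2 + p.eval x.length)) ∈ M := by
  -- the `P` predicate with truncated coins and the advice moved out, and its majority vote
  set g := swapFn ∘ mapSndFn (truncSndFn p) ∘ assocFn ∘ mapFstFn swapFn with hg
  set E : Language Bool := g ⁻¹' L'' with hE
  have hEP : E ∈ Classes.P := preimage_mem_P hL''P (adviceCoinFn_mem_FP p)
  set M : Language Bool :=
    {w | 1 / 2 < uniformProb (p.eval w.length) {y' : List Bool | boolPair w y' ∈ E}} with hM
  have hMPP : M ∈ PP := ⟨E, hEP, p, fun w => Iff.rfl⟩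
  -- membership of `⟨x, b⟩` in `M`
  have hmemM : ∀ x b : List Bool, boolPair x b ∈ M ↔
      1 / 2 < uniformProb (p.eval x.length) {y : List Bool | boolPair (boolPair x y) b ∈ L''} := by
    intro x b
    change 1 / 2 < uniformProb (p.eval (boolPair x b).length)
      {y' : List Bool | boolPair (boolPair x b) y' ∈ E} ↔ _
    have hset : {y' : List Bool | boolPair (boolPair x b) y' ∈ E} =
        {y' | y'.take (p.eval x.length) ∈ {y : List Bool | boolPair (boolPair x y) b ∈ L''}} := by
      ext y'
      change g (boolPair (boolPair x b) y') ∈ L'' ↔ _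
      rw [hg, adviceCoinFn_apply]
      rfl
    have hle : p.eval x.length ≤ p.eval (boolPair x b).length :=
      TM2Iter.eval_mono p (by rw [length_boolPair]; omega)
    rw [hset, uniformProb_take_of_le hle]
  refine ⟨M, hMPP, fun x => ?_⟩
  rw [hmemM, uniformProb_congr (E' := {y : List Bool |
    boolPair (boolPair x y) (adv (2 * x.length + 2 + p.eval x.length)) ∈ L''}) fun y hy => ?_]
  change boolPair x y ∈ L' ↔ _
  rw [ha (boolPair x y), length_boolPair, hy]
  rfl

/-! ### The induction -/

/-- **The induction step at quasi-polynomial granularity**: if `PP ⊆ qpSIZE` then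
`C'·qpSIZE ⊆ qpSIZE`. [folklore] -/
theorem pMajority_qpSIZE_subset
    (hPP : PP ⊆ ⋃ c : ℕ, SIZE (fun n => 2 ^ ((Nat.log 2 n + c) ^ c))) :
    pMajority (⋃ c : ℕ, SIZE (fun n => 2 ^ ((Nat.log 2 n + c) ^ c))) ⊆
      ⋃ c : ℕ, SIZE (fun n => 2 ^ ((Nat.log 2 n + c) ^ c)) := by
  intro L hL
  obtain ⟨L', hL', p, hp⟩ := hL
  obtain ⟨c₁, hc₁⟩ := Set.mem_iUnion.1 hL'
  obtain ⟨adv, hadv, ha⟩ := advice_of_mem_SIZE hc₁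
  obtain ⟨M, hMPP, hM⟩ := majority_step CircEval.EvalLang_mem_P adv ha p
  obtain ⟨c₂, hc₂⟩ := Set.mem_iUnion.1 (hPP hMPP)
  have hLS := mem_SIZE_of_advice hc₂ (fun n => adv (2 * n + 2 + p.eval n))
    (L := L) fun x => (hp x).trans (hM x)
  obtain ⟨c₃, hc₃⟩ := final_bound c₁ c₂ p
  exact Set.mem_iUnion.2 ⟨c₃, SIZE_mono (fun n => hc₃ n _ (hadv _)) hLS⟩

/-- **Every level `CₖP` is in `qpSIZE`** if `PP ⊆ qpSIZE` (induction on `k`; base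
`C₀P = P ⊆ C₁P = PP`). [folklore] -/
theorem CkP_subset_qpSIZE
    (hPP : PP ⊆ ⋃ c : ℕ, SIZE (fun n => 2 ^ ((Nat.log 2 n + c) ^ c))) (k : ℕ) :
    CkP k ⊆ ⋃ c : ℕ, SIZE (fun n => 2 ^ ((Nat.log 2 n + c) ^ c)) := by
  induction k with
  | zero => exact (P_subset_CkP 1).trans hPP
  | succ k ih =>
    intro L hL
    obtain ⟨L', hL', p, hp⟩ := hL
    exact pMajority_qpSIZE_subset hPP ⟨L', ih hL', p, hp⟩

end ChCollapseQP

/-- **Registered stub `stub_chCollapseQP`** (Bürgisser 2009, Lemma 2.5(2), quasi-polynomial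
version): if `PP` has quasi-polynomial-size circuits then so does every language of the counting
hierarchy `CH`, i.e. `PP ⊆ qpSIZE ⇒ CH ⊆ qpSIZE` with
`qpSIZE = ⋃ c, SIZE (n ↦ 2 ^ ((log₂ n + c) ^ c))`. [folklore] -/
theorem stub_chCollapseQP :
    (Literature.Computability.Complexity.PP ⊆
        ⋃ c : ℕ, Literature.Computability.Complexity.SIZE (fun n => 2 ^ ((Nat.log 2 n + c) ^ c))) →
      Literature.Computability.Complexity.CH ⊆
        ⋃ c : ℕ, Literature.Computability.Complexity.SIZE (fun n => 2 ^ ((Nat.log 2 n + c) ^ c)) := by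
  intro hPP L hL
  obtain ⟨k, hk⟩ := mem_CH_iff.1 hL
  exact ChCollapseQP.CkP_subset_qpSIZE hPP k hk

end Summit.ValiantsHypothesis.ValiantsHypothesis.Theorems.IntegralOrbitsTauBurgisserDet
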